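import Summits.NavierStokesRegularity.NavierStokesRegularity.Cruxes.ForcedSymmetry.SketchIdeator3

/-!
# Triage check (r1-3): the Transfer of card `albritton-barker-axis-pinning` is at least the route TARGET

`Bridge ∧ ForcedAxisymmetryDecaying ∧ KnownAxisLeaf → TypeIAncientLiouville` (= X, stmt-4050), by the same
case split as the card's own `crux_of_axis_pinning`; hence C⁺ ⇒ X ⇒ ForcedSymmetry and the card's line
proves the crux only by proving the target (costume test (iv)).
-/

set_option linter.dupNamespace false

namespace Summit.NavierStokesRegularity.NavierStokesRegularity.Cruxes.ForcedSymmetry.TriageR1K3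

open Summit.NavierStokesRegularity.NavierStokesRegularity.Cruxes.ForcedSymmetry.Ideator3
open Summit.NavierStokesRegularity.NavierStokesRegularity.Theses.SymmetryModuliCount

theorem axisPinning_transfer_implies_target (hB : Bridge) (hA : ForcedAxisymmetryDecaying)
    (hK : KnownAxisLeaf) : TypeIAncientLiouville := by
  intro C u hu
  have hu' : InClass C u := hu
  by_contra hz
  obtain ⟨C', v, hv, hdec, hnz⟩ := hB ⟨C, u, hu', hz⟩
  rcases hA C' v hv hdec with hzero | ⟨a, A, hA0, hskew, hsym⟩
  · exact hnz hzero
  · exact hnz (hK C' v hv hdec a A hA0 hskew hsym)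

end Summit.NavierStokesRegularity.NavierStokesRegularity.Cruxes.ForcedSymmetry.TriageR1K3
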